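import Mathlib.Topology.Algebra.UniformRing
import Literature.NumberTheory.EllipticCurves.NewformGaloisRepModLAssemblyPadicAlgClProofs
import Literature.NumberTheory.EllipticCurves.NewformsEigenpacketProofs
import Literature.NumberTheory.Automorphic.GLnAdelicStructureProofs
import HarnessLib

/-!
# Deligne–Serre 1974, Thm. 6.1: the `K_λ`-form (`thm61_exists_adicGaloisRep`), the newform form
# and the `ℚ̄_ℓ`-form are equivalent

A *proofs* file (theorems only: no definition, no named fact; D-0026), companion of
`NewformGaloisRepModLAssemblyPadicAlgClProofs` (which proves the named fact
`Literature.NumberTheory.EllipticCurves.ModularForms.DeligneSerre1974.thm61_exists_adicGaloisRep` —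
Deligne–Serre, *Formes modulaires de poids 1*, Ann. Sci. ÉNS (4) 7 (1974), Thm. 6.1, p. 520, at
every finite place — from Deligne's theorem in the `ℚ̄_ℓ`-form `hD` of the tree's Langlands cone).
Here the circle is closed: the `ℚ̄_ℓ`-form follows from Thm. 6.1 **restricted to newforms** (the
shape in which Deligne's theorem is printed elsewhere: Deligne 1971; Ribet 1977, Thm. (2.1): *"K
any number field containing the `c_p` and the values of `ε` … `ρ_λ : G → GL(2, K_λ)`"*;
Diamond–Shurman Thm. 9.6.5), hence from Thm. 6.1 itself.  So in the tree the three printed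
shapes of Deligne's theorem are **equivalent**, and each of them discharges the named fact:

* `deligne_padicAlgCl_of_thm61_newform` — Thm. 6.1 for newforms (hypothesis `h61`, verbatim that
  of `thm67_weightOne_of_thm61_newform`: newform `g ∈ S_k(Γ₁(M))`, `k ≥ 2`, a number field
  `K ⊆ ℂ` containing the `a_n(g)` and `ε_g(d)`, every finite place `v` of `K`, a continuous
  `ρ : Gal(ℚ̄/ℚ) → GL₂(K_v)` unramified at `p ∤ M`, `p ∉ v` with
  `det(X - ρ(F_p)) = X² - a_p X + ε(p) p^{k-1}`; no semisimplicity asked) **implies** the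
  `ℚ̄_ℓ`-form `hD` (for every eigenform, every `ℓ`, every `ι : ℚ̄_ℓ ≃ ℂ`, a continuous
  **semisimple** `r : Gal(ℚ̄/ℚ) → GL₂(ℚ̄_ℓ)` …);
* `thm61_newform_of_thm61` — Thm. 6.1 (`thm61_exists_adicGaloisRep`) implies its newform form;
* `deligne_padicAlgCl_of_thm61` — hence Thm. 6.1 implies the `ℚ̄_ℓ`-form (converse of
  `thm61_exists_adicGaloisRep_of_deligne_padicAlgCl`);
* `thm61_exists_adicGaloisRep_of_thm61_newform` — and Thm. 6.1 for newforms implies Thm. 6.1 for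
  all eigenforms at every place (through the `ℚ̄_ℓ`-form and
  `thm61_exists_adicGaloisRep_of_deligne_padicAlgCl`); `thm61_exists_adicGaloisRep_iff_newform`;
* `thm61_exists_adicGaloisRep_of_langS27_of_dictionary'` — Thm. 6.1 modulo lang.S27 and the adelic
  dictionary, with the compactness fact of the `GL₂/ℚ` datum discharged
  (`isCompact_glFiniteIntegralLevel_holds`).

## Proof of `deligne_padicAlgCl_of_thm61_newform`

Given an eigenform `g ∈ S_k(Γ₁(M), χ)` with eigenvalues `a_p` (`p ∤ M`), `ℓ` and `ι : ℚ̄_ℓ ≃ ℂ`: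
the packet of `g` is that of a newform `g₀` of level `M₀ ∣ M` (Atkin–Lehner–Li,
`exists_isNewform1_of_eigenpacket`), whose coefficient field `K = K_{g₀}` is a number field
((2.7.2)–(2.7.3), proved in the tree); `ι⁻¹|_K : K → ℚ̄_ℓ` induces a place `v ∣ ℓ` of `K`
(`exists_heightOneSpectrum_of_ringHom_padicAlgCl`) and extends to a continuous `ĵ : K_v → ℚ̄_ℓ`
(`exists_continuous_ringHom_adicCompletion_extends`: `j(K)` lies in a finite, complete extension
of `ℚ_ℓ`, and `j` is `v`-adically continuous); `h61` at `(g₀, K, v)` gives `ρ` over `K_v`, whose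
base change `r₀ = ĵ ∘ ρ` has the required Frobenius polynomials (`a_p(g₀) = a_p`,
`ε_{g₀}(p) = χ(p)` for `p ∤ M`); `r₀` is odd (`isOdd_of_deligne_padicAlgCl`, Chebotarev), so the
descent lemma along the identity of `ℚ̄_ℓ`
(`Literature.RepresentationTheory.Semisimple.exists_continuous_descent_fin_two_of_det_eq_neg_one`)
replaces it by a continuous **semisimple** `r` with the same characteristic polynomials and no
more ramification (a semisimplification; Deligne–Serre 6.12).

## References

* P. Deligne, J.-P. Serre, *Formes modulaires de poids 1*, Ann. Sci. ÉNS (4) 7 (1974), 507–530: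
  Thm. 6.1 (p. 520), footnote (2) (p. 521), 6.12. doi:10.24033/asens.1277 [DeligneSerreASENS1974]
* K. A. Ribet, *Galois representations attached to eigenforms with Nebentypus*, LNM 601 (1977),
  Thm. (2.1), Prop. (2.2). [Ribet1977Nebentypus]
* F. Diamond, J. Shurman, *A First Course in Modular Forms*, GTM 228 (2005), Thm. 5.8.2–5.8.3,
  Thm. 9.6.5. [DiamondShurman2005]
* J. Neukirch, *Algebraic Number Theory* (1999), Ch. II (8.1)–(8.2) (places above `ℓ` and
  embeddings into `ℚ̄_ℓ`). [NeukirchANT1999]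
-/

noncomputable section

open scoped MatrixGroups ModularForm NumberField Polynomial NNReal Topology

open CongruenceSubgroup IsDedekindDomain Polynomial Rat.HeightOneSpectrum Field Topology Filter
  Literature.NumberTheory.GaloisRepresentations Literature.NumberTheory.Automorphic

namespace Literature.NumberTheory.EllipticCurves.ModularForms.DeligneSerre1974

/-! ### The place of a number field induced by an embedding into `ℚ̄_ℓ` -/

section PlaceOfEmbedding

variable {K : Type} [Field K] [NumberField K] {ℓ : ℕ} [Fact ℓ.Prime]

/-- **The place induced by an embedding `j : K → ℚ̄_ℓ`.** For a number field `K` and a ring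
homomorphism `j : K → ℚ̄_ℓ` there is a finite place `v ∣ ℓ` of `K` with `j(𝓞 K) ⊆ ℤ̄_ℓ` and
`j⁻¹(𝔪_{ℤ̄_ℓ}) ∩ 𝓞 K = v`: algebraic integers have `|j x| ≤ 1`, and the pull-back of the maximal
ideal of `ℤ̄_ℓ` is a prime of `𝓞 K` containing `ℓ` (`|ℓ|_ℓ < 1`), hence non-zero.
(Neukirch, *Algebraic Number Theory*, Ch. II (8.1)–(8.2).) [cite: NeukirchANT1999, Ch. II (8.1)–(8.2)] -/
theorem exists_heightOneSpectrum_of_ringHom_padicAlgCl (j : K →+* PadicAlgCl ℓ) :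
    ∃ v : HeightOneSpectrum (𝓞 K), ((ℓ : ℕ) : 𝓞 K) ∈ v.asIdeal ∧
      (∀ r : 𝓞 K, Valued.v (j r) ≤ 1) ∧ ∀ r : 𝓞 K, Valued.v (j r) < 1 ↔ r ∈ v.asIdeal := by
  classical
  have hℓ : ℓ.Prime := Fact.out
  -- `j(𝓞 K) ⊆ ℤ̄_ℓ`
  have hint : ∀ r : 𝓞 K, j (r : K) ∈ padicAlgClIntegers ℓ := fun r ↦
    mem_padicAlgClIntegers_of_isIntegral
      ((NumberField.RingOfIntegers.isIntegral_coe r).map j.toIntAlgHom)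
  let ψ : 𝓞 K →+* padicAlgClIntegers ℓ :=
    { toFun := fun r ↦ ⟨j (r : K), hint r⟩
      map_one' := Subtype.ext (by simp)
      map_mul' := fun x y ↦ Subtype.ext (by simp)
      map_zero' := Subtype.ext (by simp)
      map_add' := fun x y ↦ Subtype.ext (by simp) }
  have hψ : ∀ r : 𝓞 K, ((ψ r : padicAlgClIntegers ℓ) : PadicAlgCl ℓ) = j (r : K) := fun _ ↦ rfl
  -- the pulled-back prime
  let I : Ideal (𝓞 K) := (IsLocalRing.maximalIdeal (padicAlgClIntegers ℓ)).comap ψ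
  haveI hI : I.IsPrime := Ideal.IsPrime.comap ψ
  have hmemI : ∀ r : 𝓞 K, r ∈ I ↔ Valued.v (j (r : K)) < 1 := fun r ↦ by
    rw [Ideal.mem_comap, mem_maximalIdeal_padicAlgClIntegers_iff, hψ]
  have hℓval : Valued.v ((ℓ : ℕ) : PadicAlgCl ℓ) < 1 := by
    rw [PadicAlgCl.valuation_p ℓ, one_div]
    exact inv_lt_one_of_one_lt₀ (by exact_mod_cast hℓ.one_lt)
  have hℓI : ((ℓ : ℕ) : 𝓞 K) ∈ I := by
    rw [hmemI]
    simpa using hℓval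
  have hIbot : I ≠ ⊥ := by
    intro h
    rw [h, Ideal.mem_bot] at hℓI
    exact hℓ.ne_zero (by exact_mod_cast hℓI)
  refine ⟨⟨I, hI, hIbot⟩, hℓI, fun r ↦ ?_, fun r ↦ ?_⟩
  · exact (Valuation.mem_valuationSubring_iff _ _).mp (hint r)
  · exact (hmemI r).symm

end PlaceOfEmbedding

/-! ### An embedding inducing `v` extends continuously to `K_v` -/

section Extension

variable {K : Type} [Field K] [NumberField K] {ℓ : ℕ} [Fact ℓ.Prime]

set_option maxHeartbeats 800000 in
/-- **An embedding `j : K → ℚ̄_ℓ` inducing the place `v` extends to a continuous embedding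
`K_v → ℚ̄_ℓ`** (Neukirch, *Algebraic Number Theory*, Ch. II (8.2): the places of `K` above `ℓ`
are the classes of embeddings `K → ℚ̄_ℓ`, the completion at `v` being the closure of `j(K)`).
Proof: `j(K)` lies in the finite, hence complete, extension `F = ℚ_ℓ(j(K))` of `ℚ_ℓ` inside
`ℚ̄_ℓ` (generated by the image of a `ℚ`-basis); `j : K → F` is continuous for the `v`-adic
topology (if `v(x) < v(ℓⁿ)` then `|j x| < ℓ⁻ⁿ`, as `j` induces `v`:
`valued_lt_one_iff_valuation_lt_one`), so it extends to the completion
(Mathlib `UniformSpace.Completion.extensionHom`). [cite: NeukirchANT1999, Ch. II (8.2)] -/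
theorem exists_continuous_ringHom_adicCompletion_extends (v : HeightOneSpectrum (𝓞 K))
    (hℓv : ((ℓ : ℕ) : 𝓞 K) ∈ v.asIdeal) (j : K →+* PadicAlgCl ℓ)
    (hjint : ∀ r : 𝓞 K, Valued.v (j r) ≤ 1) (hjv : ∀ r : 𝓞 K, Valued.v (j r) < 1 ↔ r ∈ v.asIdeal) :
    ∃ ĵ : v.adicCompletion K →+* PadicAlgCl ℓ, Continuous ĵ ∧
      ∀ x : K, ĵ (x : v.adicCompletion K) = j x := by
  classical
  have hℓ : ℓ.Prime := Fact.out
  -- ### the finite extension `F ⊇ j(K)` of `ℚ_ℓ` inside `ℚ̄_ℓ`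
  let b := Module.finBasis ℚ K
  let F : IntermediateField ℚ_[ℓ] (PadicAlgCl ℓ) :=
    IntermediateField.adjoin ℚ_[ℓ] (Set.range fun i ↦ j (b i))
  haveI : FiniteDimensional ℚ_[ℓ] F := by
    apply IntermediateField.finiteDimensional_adjoin
    rintro _ ⟨i, rfl⟩
    exact Algebra.IsIntegral.isIntegral _
  have hjF : ∀ x : K, j x ∈ F := by
    intro x
    have hx : x = ∑ i, (b.repr x i) • b i := (b.sum_repr x).symm
    rw [hx, map_sum]
    refine Subalgebra.sum_mem _ fun i _ ↦ ?_
    rw [Algebra.smul_def, map_mul, eq_ratCast, map_ratCast]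
    refine Subalgebra.mul_mem _ ?_ (IntermediateField.subset_adjoin _ _ ⟨i, rfl⟩)
    have : ((b.repr x i : ℚ) : PadicAlgCl ℓ) = algebraMap ℚ_[ℓ] (PadicAlgCl ℓ) (b.repr x i : ℚ) := by
      rw [map_ratCast]
    rw [this]
    exact F.algebraMap_mem _
  haveI : CompleteSpace F := FiniteDimensional.complete ℚ_[ℓ] F
  -- `j` corestricted to `F`, on the valued copy `WithVal` of `K`
  let jF : WithVal (v.valuation K) →+* F :=
    { toFun := fun x ↦ ⟨j x.ofVal, hjF _⟩
      map_one' := Subtype.ext (by simp)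
      map_mul' := fun x y ↦ Subtype.ext (by simp)
      map_zero' := Subtype.ext (by simp)
      map_add' := fun x y ↦ Subtype.ext (by simp) }
  have hjF_apply : ∀ x : WithVal (v.valuation K), ((jF x : F) : PadicAlgCl ℓ) = j x.ofVal :=
    fun _ ↦ rfl
  -- ### continuity of `jF` for the `v`-adic topology
  have hℓK : (ℓ : K) ≠ 0 := by exact_mod_cast hℓ.ne_zero
  have hnormℓ : ‖((ℓ : ℕ) : PadicAlgCl ℓ)‖ = (ℓ : ℝ)⁻¹ := by
    rw [← map_natCast (algebraMap ℚ_[ℓ] (PadicAlgCl ℓ)) ℓ]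
    change ‖((ℓ : ℚ_[ℓ]) : PadicAlgCl ℓ)‖ = _
    rw [PadicAlgCl.norm_extends, Padic.norm_p]
  have hest : ∀ (n : ℕ) (y : K), v.valuation K y < v.valuation K ((ℓ : K) ^ n) →
      ‖j y‖ < ((ℓ : ℝ)⁻¹) ^ n := by
    intro n y hy
    have hℓn : (ℓ : K) ^ n ≠ 0 := pow_ne_zero _ hℓK
    have hvℓn : v.valuation K ((ℓ : K) ^ n) ≠ 0 := (_root_.map_ne_zero _).mpr hℓn
    set z : K := y / (ℓ : K) ^ n with hz
    have hz1 : v.valuation K z < 1 := by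
      rw [hz, map_div₀, div_lt_one₀ (zero_lt_iff.mpr hvℓn)]
      exact hy
    have hjz : Valued.v (j z) < 1 := (valued_lt_one_iff_valuation_lt_one j v hℓv hjint hjv z).mpr hz1
    have hjz' : ‖j z‖ < 1 := by
      rw [PadicAlgCl.valuation_def] at hjz
      rw [← coe_nnnorm]
      exact_mod_cast hjz
    have hy' : y = z * (ℓ : K) ^ n := by rw [hz, div_mul_cancel₀ _ hℓn]
    rw [hy', map_mul, map_pow, norm_mul, norm_pow, map_natCast, hnormℓ]
    have hpos : (0 : ℝ) < ((ℓ : ℝ)⁻¹) ^ n := pow_pos (inv_pos.mpr (by exact_mod_cast hℓ.pos)) n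
    calc ‖j z‖ * ((ℓ : ℝ)⁻¹) ^ n < 1 * ((ℓ : ℝ)⁻¹) ^ n := by gcongr
      _ = ((ℓ : ℝ)⁻¹) ^ n := one_mul _
  have hcont : Continuous jF := by
    refine continuous_of_continuousAt_zero jF.toAddMonoidHom ?_
    change ContinuousAt jF 0
    rw [ContinuousAt, map_zero, NormedAddGroup.tendsto_nhds_zero]
    intro ε hε
    obtain ⟨n, hn⟩ : ∃ n : ℕ, ((ℓ : ℝ)⁻¹) ^ n < ε :=
      exists_pow_lt_of_lt_one hε (inv_lt_one_of_one_lt₀ (by exact_mod_cast hℓ.one_lt))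
    -- the open ball `{x | v x < v(ℓⁿ)}` is a neighbourhood of `0`
    let x₀ : WithVal (v.valuation K) := WithVal.toVal _ ((ℓ : K) ^ n)
    have hx₀ : Valued.v x₀ ≠ 0 := by
      change v.valuation K ((ℓ : K) ^ n) ≠ 0
      exact (_root_.map_ne_zero _).mpr (pow_ne_zero _ hℓK)
    have hU : {x : WithVal (v.valuation K) | Valued.v.restrict x < Valued.v.restrict x₀} ∈ 𝓝 0 := by
      refine (Valued.isOpen_ball _ _).mem_nhds ?_
      rw [Set.mem_setOf_eq, Valuation.restrict_lt_iff, map_zero]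
      exact zero_lt_iff.mpr hx₀
    filter_upwards [hU] with x hx
    rw [Valuation.restrict_lt_iff] at hx
    have hx' : v.valuation K x.ofVal < v.valuation K ((ℓ : K) ^ n) := hx
    have h1 := hest n x.ofVal hx'
    calc ‖jF x‖ = ‖j x.ofVal‖ := rfl
      _ < ((ℓ : ℝ)⁻¹) ^ n := h1
      _ < ε := hn
  -- ### extension to the completion
  let ext₀ : (v.valuation K).Completion →+* F := UniformSpace.Completion.extensionHom jF hcont
  have hext₀ : Continuous ext₀ := UniformSpace.Completion.continuous_extension
  let ĵ : v.adicCompletion K →+* PadicAlgCl ℓ :=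
    (F.val.toRingHom.comp ext₀).comp (HeightOneSpectrum.adicCompletion.equiv K v).toRingHom
  refine ⟨ĵ, ?_, fun x ↦ ?_⟩
  · exact (continuous_subtype_val.comp hext₀).comp
      (HeightOneSpectrum.adicCompletion.continuous_toCompletion K v)
  · change ((ext₀ ((x : v.adicCompletion K).toCompletion) : F) : PadicAlgCl ℓ) = j x
    rw [HeightOneSpectrum.adicCompletion.coe_toCompletion]
    change ((ext₀ ((WithVal.toVal (v.valuation K) x : WithVal (v.valuation K)) :
      (v.valuation K).Completion) : F) : PadicAlgCl ℓ) = j x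
    rw [show ext₀ ((WithVal.toVal (v.valuation K) x : WithVal (v.valuation K)) :
        (v.valuation K).Completion) = jF (WithVal.toVal (v.valuation K) x) from
      UniformSpace.Completion.extensionHom_coe jF hcont _]
    rfl

end Extension

/-! ### The `ℚ̄_ℓ`-form from Thm. 6.1 for newforms -/

section Converse

set_option maxHeartbeats 1600000 in
/-- **Deligne's theorem in `ℚ̄_ℓ`-form from Deligne–Serre's Thm. 6.1 restricted to newforms.**
Hypothesis `h61`: verbatim that of `thm67_weightOne_of_thm61_newform` (Thm. 6.1 for a newform
`g ∈ S_k(Γ₁(M))`, `k ≥ 2`, a number field `K ⊆ ℂ` containing the `a_n(g)` and the `ε_g(d)`, and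
every finite place `v` of `K`: a continuous `ρ : Gal(ℚ̄/ℚ) → GL₂(K_v)` unramified at `p ∤ M`,
`p ∉ v`, with `det(X - ρ(F_p)) = X² - a_p X + ε_g(p) p^{k-1}`; Ribet 1977, Thm. (2.1);
Diamond–Shurman Thm. 9.6.5 with any `K ⊇ K_g`).  Conclusion: the `ℚ̄_ℓ`-form `hD` of
`thm61_exists_adicGaloisRep_of_deligne_padicAlgCl` / `thm67_weightOne_of_deligne_padicAlgCl'` —
for every cuspidal `T_p`-eigenform `g ∈ S_k(Γ₁(M), χ)`, `k ≥ 2`, every `ℓ` and every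
`ι : ℚ̄_ℓ ≃+* ℂ`, a continuous semisimple `r : Gal(ℚ̄/ℚ) → GL₂(ℚ̄_ℓ)` unramified at `p ∤ M`,
`p ≠ ℓ`, with `det(X - r(F_p)) = X² - ι⁻¹(a_p) X + ι⁻¹(χ(p) p^{k-1})`.  Proof: see the module
docstring (newform behind the packet, place induced by `ι⁻¹`, continuous extension to `K_v`,
base change, oddness, semisimplification by descent along the identity).
[cite: DeligneSerreASENS1974, Thm. 6.1 (p. 520), 6.12] [cite: Ribet1977Nebentypus, Thm. (2.1)] -/
theorem deligne_padicAlgCl_of_thm61_newform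
    (h61 : ∀ (M : ℕ) [NeZero M] (k : ℤ), 2 ≤ k → ∀ (g : CuspForm (Gamma1 M) k), IsNewform1 g →
      ∀ (K : IntermediateField ℚ ℂ) [NumberField K] (a : ℕ → K) (c : ZMod M → K),
        (∀ n, ((a n : K) : ℂ) = cuspCoeff g n) → (∀ d, ((c d : K) : ℂ) = nebentypus g d) →
      ∀ v : HeightOneSpectrum (𝓞 K),
        ∃ ρ : GaloisRepresentations.FramedGaloisRep ℚ (v.adicCompletion K) 2,
          ∀ w : HeightOneSpectrum (𝓞 ℚ), ¬ ((primesEquiv w : Nat.Primes) : ℕ) ∣ M →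
            (((primesEquiv w : Nat.Primes) : ℕ) : 𝓞 K) ∉ v.asIdeal →
            ρ.IsUnramifiedAt w ∧
            ρ.HasFrobCharpolyAt w
              ((X ^ 2 - C (a ((primesEquiv w : Nat.Primes) : ℕ)) * X +
                C (c ((primesEquiv w : Nat.Primes) : ℕ) *
                  (((primesEquiv w : Nat.Primes) : ℕ) : K) ^ (k - 1))).map
                (algebraMap K (v.adicCompletion K))))
    (M : ℕ) [NeZero M] (k : ℤ) (hk : 2 ≤ k)
    (g : CuspForm (Gamma1 M) k) (χ : DirichletCharacter ℂ M)
    (hgχ : g ∈ nebentypusSubspace M k χ) (hg0 : g ≠ 0) (a : ℕ → ℂ)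
    (hT : ∀ (p : ℕ) (hp : p.Prime), ¬ p ∣ M →
      (haveI : NeZero p := ⟨hp.ne_zero⟩; heckeT (Gamma1 M) k p g) = a p • g)
    (ℓ : ℕ) [Fact ℓ.Prime] (ι : PadicAlgCl ℓ ≃+* ℂ) :
    ∃ r : GaloisRepresentations.FramedGaloisRep ℚ (PadicAlgCl ℓ) 2,
      r.toGaloisRep.IsSemisimple ∧
      ∀ w : HeightOneSpectrum (𝓞 ℚ), ¬ ((primesEquiv w : Nat.Primes) : ℕ) ∣ M →
        ((primesEquiv w : Nat.Primes) : ℕ) ≠ ℓ →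
        r.IsUnramifiedAt w ∧
        r.HasFrobCharpolyAt w
          (X ^ 2 - C (ι.symm (a ((primesEquiv w : Nat.Primes) : ℕ))) * X +
            C (ι.symm (χ ((primesEquiv w : Nat.Primes) : ℕ) *
              (((primesEquiv w : Nat.Primes) : ℕ) : ℂ) ^ (k - 1)))) := by
  classical
  have hℓ : ℓ.Prime := Fact.out
  -- ### the newform `g₀` behind the packet of `g` (Atkin–Lehner–Li)
  obtain ⟨M₀, _, hM₀, g₀, hg₀, ha₀, hχ₀⟩ := exists_isNewform1_of_eigenpacket hg0 hgχ hT
  -- its coefficient field `K`, a number field (Deligne–Serre (2.7.2)–(2.7.3), proved in the tree)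
  haveI : FiniteDimensional ℚ (coeffField g₀) :=
    (IsNewform1.finiteDimensional_coeffField_of_span_integralLattice1
      (DeligneSerre1974_span_integralLattice1_holds M₀ k)) hg₀
  haveI : FiniteDimensional ℚ (coeffCharField g₀) :=
    DeligneSerre1974.finiteDimensional_coeffCharField g₀
  haveI : NumberField (coeffCharField g₀) := NumberField.mk
  let aK : ℕ → coeffCharField g₀ := fun n ↦ ⟨cuspCoeff g₀ n, cuspCoeff_mem_coeffCharField g₀ n⟩
  let cK : ZMod M₀ → coeffCharField g₀ := fun d ↦ nebentypusCoeff g₀ d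
  have haK : ∀ n, ((aK n : coeffCharField g₀) : ℂ) = cuspCoeff g₀ n := fun _ ↦ rfl
  have hcK : ∀ d, ((cK d : coeffCharField g₀) : ℂ) = nebentypus g₀ d := fun _ ↦ rfl
  -- ### the place `v ∣ ℓ` of `K` induced by `ι⁻¹`, and `ĵ : K_v → ℚ̄_ℓ` extending `ι⁻¹|_K`
  set jK : coeffCharField g₀ →+* PadicAlgCl ℓ :=
    (ι.symm : ℂ →+* PadicAlgCl ℓ).comp (algebraMap (coeffCharField g₀) ℂ) with hjKdef
  have hjK : ∀ y : coeffCharField g₀, jK y = ι.symm (y : ℂ) := fun _ ↦ rfl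
  obtain ⟨v, hℓv, hjint, hjv⟩ := exists_heightOneSpectrum_of_ringHom_padicAlgCl jK
  obtain ⟨ĵ, hĵ, hĵK⟩ := exists_continuous_ringHom_adicCompletion_extends v hℓv jK hjint hjv
  have hĵalg : ĵ.comp (algebraMap (coeffCharField g₀) (v.adicCompletion (coeffCharField g₀))) = jK :=
    RingHom.ext fun x ↦ hĵK x
  -- ### Thm. 6.1 for the newform `g₀` at `v`, base-changed to `ℚ̄_ℓ`
  obtain ⟨ρ, hρ⟩ := h61 M₀ k hk g₀ hg₀ (coeffCharField g₀) aK cK haK hcK v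
  let r₀ : FramedGaloisRep ℚ (PadicAlgCl ℓ) 2 := FramedRep.baseChange ĵ hĵ ρ
  have hr₀val : ∀ σ, ((r₀ σ : GL (Fin 2) (PadicAlgCl ℓ)) : Matrix (Fin 2) (Fin 2) (PadicAlgCl ℓ)) =
      ((ρ σ : GL (Fin 2) (v.adicCompletion (coeffCharField g₀))) :
        Matrix (Fin 2) (Fin 2) (v.adicCompletion (coeffCharField g₀))).map ĵ := fun _ ↦ rfl
  have hr₀ : ∀ w : HeightOneSpectrum (𝓞 ℚ), ¬ ((primesEquiv w : Nat.Primes) : ℕ) ∣ M →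
      ((primesEquiv w : Nat.Primes) : ℕ) ≠ ℓ →
      r₀.IsUnramifiedAt w ∧
      r₀.HasFrobCharpolyAt w
        (X ^ 2 - C (ι.symm (a ((primesEquiv w : Nat.Primes) : ℕ))) * X +
          C (ι.symm (χ ((primesEquiv w : Nat.Primes) : ℕ) *
            (((primesEquiv w : Nat.Primes) : ℕ) : ℂ) ^ (k - 1)))) := by
    intro w hw hwℓ
    set p : ℕ := ((primesEquiv w : Nat.Primes) : ℕ) with hpdef
    have hp : p.Prime := (primesEquiv w).2
    have hpM₀ : ¬ p ∣ M₀ := fun h ↦ hw (h.trans hM₀)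
    have hpv : ((p : ℕ) : 𝓞 (coeffCharField g₀)) ∉ v.asIdeal :=
      natCast_not_mem_of_prime_ne v ℓ hp hℓ hwℓ hℓv
    obtain ⟨hunr, hchar⟩ := hρ w hpM₀ hpv
    rw [← hpdef] at hchar
    refine ⟨fun 𝔓 h𝔓 σ hσ ↦ ?_, fun 𝔓 h𝔓 σ hσ ↦ ?_⟩
    · change Matrix.GeneralLinearGroup.map ĵ (ρ σ) = 1
      rw [hunr 𝔓 h𝔓 σ hσ, map_one]
    · have h1 := hchar 𝔓 h𝔓 σ hσ
      -- the coefficients: `a_p(g₀) = a_p` and `ε_{g₀}(p) = χ(p)` for `p ∤ M`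
      have hχp : χ (p : ZMod M) = nebentypus g₀ (p : ZMod M₀) := by
        have hcop : IsCoprime (p : ℤ) (M : ℤ) :=
          Nat.isCoprime_iff_coprime.mpr ((Nat.Prime.coprime_iff_not_dvd hp).mpr hw)
        have := DirichletCharacter.changeLevel_eq_cast_of_dvd' (nebentypus g₀) hM₀ hcop
        rw [hχ₀] at this
        simpa using this
      have h2 : jK (aK p) = ι.symm (a p) := by
        change ι.symm (algebraMap (coeffCharField g₀) ℂ (aK p)) = _
        rw [← ha₀ p hp hw]
        rfl
      have h3 : jK (cK (p : ZMod M₀) * ((p : ℕ) : coeffCharField g₀) ^ (k - 1)) =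
          ι.symm (χ (p : ZMod M) * (p : ℂ) ^ (k - 1)) := by
        change ι.symm (algebraMap (coeffCharField g₀) ℂ
          (cK (p : ZMod M₀) * ((p : ℕ) : coeffCharField g₀) ^ (k - 1))) = _
        rw [map_mul, map_zpow₀, map_natCast (algebraMap (coeffCharField g₀) ℂ), hχp]
        rfl
      change (((r₀ σ : GL (Fin 2) (PadicAlgCl ℓ)) : Matrix (Fin 2) (Fin 2) (PadicAlgCl ℓ))).charpoly = _
      rw [hr₀val, Matrix.charpoly_map]
      change (FramedRep.charpoly ρ σ).map ĵ = _
      rw [h1, Polynomial.map_map, hĵalg]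
      simp only [Polynomial.map_add, Polynomial.map_sub, Polynomial.map_mul, Polynomial.map_pow,
        Polynomial.map_X, Polynomial.map_C, h2, h3]
  -- ### oddness, and semisimplification by descent along the identity of `ℚ̄_ℓ`
  have hodd : r₀.IsOdd := isOdd_of_deligne_padicAlgCl (by omega) hgχ hg0 ι a r₀ hr₀
  obtain ⟨c₀, hc₀⟩ := exists_isComplexConjugation (Rat.castHom ℝ)
  have hdetc : ((r₀ c₀ : GL (Fin 2) (PadicAlgCl ℓ)) : Matrix (Fin 2) (Fin 2) (PadicAlgCl ℓ)).det = -1 := by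
    have h := congrArg Units.val (hodd _ c₀ hc₀)
    rwa [Matrix.GeneralLinearGroup.val_det_apply, Units.val_neg, Units.val_one] at h
  have hcc : c₀ * c₀ = 1 := by
    have h := hc₀.sq_eq_one
    rwa [pow_two] at h
  obtain ⟨r, hrss, hrchar, hrker⟩ :=
    Literature.RepresentationTheory.Semisimple.exists_continuous_descent_fin_two_of_det_eq_neg_one
      (RingHom.id (PadicAlgCl ℓ)) IsInducing.id r₀ two_ne_zero (fun σ ↦ ⟨_, rfl⟩) hcc hdetc
  refine ⟨r, hrss, fun w hw hwℓ ↦ ?_⟩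
  obtain ⟨hunr, hchar⟩ := hr₀ w hw hwℓ
  refine ⟨fun 𝔓 h𝔓 σ hσ ↦ hrker σ (hunr 𝔓 h𝔓 σ hσ), fun 𝔓 h𝔓 σ hσ ↦ ?_⟩
  have h1 := hchar 𝔓 h𝔓 σ hσ
  have h2 := hrchar σ
  rw [RingHom.coe_id, Matrix.map_id] at h2
  change (((r σ : GL (Fin 2) (PadicAlgCl ℓ)) : Matrix (Fin 2) (Fin 2) (PadicAlgCl ℓ))).charpoly = _
  rw [h2]
  exact h1

/-- **Thm. 6.1 (`thm61_exists_adicGaloisRep`) implies its restriction to newforms** (the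
hypothesis shape `h61` of `thm67_weightOne_of_thm61_newform` / `deligne_padicAlgCl_of_thm61_newform`):
a newform `g` is a non-zero `T_p`-eigenform of type `(k, ε_g)` with eigenvalues `a_p(g)`
(`IsNewform1.heckeEigenvalue_eq_coeff_holds`, `IsNewform1.mem_nebentypusSubspace_nebentypus_holds`),
and a subfield `K ⊆ ℂ` is a number field embedded by the inclusion; the semisimplicity of
Thm. 6.1 is dropped. [cite: DeligneSerreASENS1974, Thm. 6.1 (p. 520)] -/
theorem thm61_newform_of_thm61 (h : thm61_exists_adicGaloisRep) :
    ∀ (M : ℕ) [NeZero M] (k : ℤ), 2 ≤ k → ∀ (g : CuspForm (Gamma1 M) k), IsNewform1 g →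
      ∀ (K : IntermediateField ℚ ℂ) [NumberField K] (a : ℕ → K) (c : ZMod M → K),
        (∀ n, ((a n : K) : ℂ) = cuspCoeff g n) → (∀ d, ((c d : K) : ℂ) = nebentypus g d) →
      ∀ v : HeightOneSpectrum (𝓞 K),
        ∃ ρ : GaloisRepresentations.FramedGaloisRep ℚ (v.adicCompletion K) 2,
          ∀ w : HeightOneSpectrum (𝓞 ℚ), ¬ ((primesEquiv w : Nat.Primes) : ℕ) ∣ M →
            (((primesEquiv w : Nat.Primes) : ℕ) : 𝓞 K) ∉ v.asIdeal →
            ρ.IsUnramifiedAt w ∧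
            ρ.HasFrobCharpolyAt w
              ((X ^ 2 - C (a ((primesEquiv w : Nat.Primes) : ℕ)) * X +
                C (c ((primesEquiv w : Nat.Primes) : ℕ) *
                  (((primesEquiv w : Nat.Primes) : ℕ) : K) ^ (k - 1))).map
                (algebraMap K (v.adicCompletion K))) := by
  intro M _ k hk g hg K _ a c ha hc v
  have hT : ∀ (p : ℕ) (hp : p.Prime), ¬ p ∣ M →
      (haveI : NeZero p := ⟨hp.ne_zero⟩; heckeT (Gamma1 M) k p g) =
        (algebraMap K ℂ) (a p) • g := by
    intro p hp _
    haveI : NeZero p := ⟨hp.ne_zero⟩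
    rw [heckeT_eq_heckeEigenvalue_smul g p (hg.2.1 p hp),
      IsNewform1.heckeEigenvalue_eq_coeff_holds hg hp]
    exact congrArg (· • g) (ha p).symm
  obtain ⟨ρ, -, hρ⟩ := h M k hk g (nebentypus g) (IsNewform1.mem_nebentypusSubspace_nebentypus_holds hg)
    hg.ne_zero K (algebraMap K ℂ) a c hc hT v
  exact ⟨ρ, hρ⟩

/-- **Deligne's theorem in `ℚ̄_ℓ`-form from Thm. 6.1 (`thm61_exists_adicGaloisRep`)** — the
converse of `thm61_exists_adicGaloisRep_of_deligne_padicAlgCl`, so that the two shapes are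
equivalent in the tree: `deligne_padicAlgCl_of_thm61_newform` after `thm61_newform_of_thm61`.
[cite: DeligneSerreASENS1974, Thm. 6.1 (p. 520)] -/
theorem deligne_padicAlgCl_of_thm61 (h : thm61_exists_adicGaloisRep)
    (M : ℕ) [NeZero M] (k : ℤ) (hk : 2 ≤ k)
    (g : CuspForm (Gamma1 M) k) (χ : DirichletCharacter ℂ M)
    (hgχ : g ∈ nebentypusSubspace M k χ) (hg0 : g ≠ 0) (a : ℕ → ℂ)
    (hT : ∀ (p : ℕ) (hp : p.Prime), ¬ p ∣ M →
      (haveI : NeZero p := ⟨hp.ne_zero⟩; heckeT (Gamma1 M) k p g) = a p • g)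
    (ℓ : ℕ) [Fact ℓ.Prime] (ι : PadicAlgCl ℓ ≃+* ℂ) :
    ∃ r : GaloisRepresentations.FramedGaloisRep ℚ (PadicAlgCl ℓ) 2,
      r.toGaloisRep.IsSemisimple ∧
      ∀ w : HeightOneSpectrum (𝓞 ℚ), ¬ ((primesEquiv w : Nat.Primes) : ℕ) ∣ M →
        ((primesEquiv w : Nat.Primes) : ℕ) ≠ ℓ →
        r.IsUnramifiedAt w ∧
        r.HasFrobCharpolyAt w
          (X ^ 2 - C (ι.symm (a ((primesEquiv w : Nat.Primes) : ℕ))) * X +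
            C (ι.symm (χ ((primesEquiv w : Nat.Primes) : ℕ) *
              (((primesEquiv w : Nat.Primes) : ℕ) : ℂ) ^ (k - 1)))) :=
  deligne_padicAlgCl_of_thm61_newform (thm61_newform_of_thm61 h) M k hk g χ hgχ hg0 a hT ℓ ι

/-- **Thm. 6.1 for newforms implies Thm. 6.1 for all eigenforms at every finite place
(`thm61_exists_adicGaloisRep`)**, through the `ℚ̄_ℓ`-form (`deligne_padicAlgCl_of_thm61_newform`)
and the descent of `thm61_exists_adicGaloisRep_of_deligne_padicAlgCl`. In particular the named
fact `thm61_exists_adicGaloisRep` is discharged by Deligne's theorem in ANY of its printed shapes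
(Deligne–Serre Thm. 6.1; Ribet 1977, Thm. (2.1) / Diamond–Shurman Thm. 9.6.5 for newforms; the
`ℚ̄_ℓ`-form of the Langlands cone). [cite: DeligneSerreASENS1974, Thm. 6.1 (p. 520)]
[cite: Ribet1977Nebentypus, Thm. (2.1)] -/
theorem thm61_exists_adicGaloisRep_of_thm61_newform
    (h61 : ∀ (M : ℕ) [NeZero M] (k : ℤ), 2 ≤ k → ∀ (g : CuspForm (Gamma1 M) k), IsNewform1 g →
      ∀ (K : IntermediateField ℚ ℂ) [NumberField K] (a : ℕ → K) (c : ZMod M → K),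
        (∀ n, ((a n : K) : ℂ) = cuspCoeff g n) → (∀ d, ((c d : K) : ℂ) = nebentypus g d) →
      ∀ v : HeightOneSpectrum (𝓞 K),
        ∃ ρ : GaloisRepresentations.FramedGaloisRep ℚ (v.adicCompletion K) 2,
          ∀ w : HeightOneSpectrum (𝓞 ℚ), ¬ ((primesEquiv w : Nat.Primes) : ℕ) ∣ M →
            (((primesEquiv w : Nat.Primes) : ℕ) : 𝓞 K) ∉ v.asIdeal →
            ρ.IsUnramifiedAt w ∧
            ρ.HasFrobCharpolyAt w
              ((X ^ 2 - C (a ((primesEquiv w : Nat.Primes) : ℕ)) * X +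
                C (c ((primesEquiv w : Nat.Primes) : ℕ) *
                  (((primesEquiv w : Nat.Primes) : ℕ) : K) ^ (k - 1))).map
                (algebraMap K (v.adicCompletion K)))) :
    thm61_exists_adicGaloisRep :=
  thm61_exists_adicGaloisRep_of_deligne_padicAlgCl
    (fun M _ k hk g χ hgχ hg0 a hT ℓ _ ι ↦
      deligne_padicAlgCl_of_thm61_newform h61 M k hk g χ hgχ hg0 a hT ℓ ι)

/-- **The three shapes are equivalent**: Thm. 6.1 at every place (`thm61_exists_adicGaloisRep`)
holds iff its newform form does. [cite: DeligneSerreASENS1974, Thm. 6.1 (p. 520)] -/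
theorem thm61_exists_adicGaloisRep_iff_newform :
    thm61_exists_adicGaloisRep ↔
    ∀ (M : ℕ) [NeZero M] (k : ℤ), 2 ≤ k → ∀ (g : CuspForm (Gamma1 M) k), IsNewform1 g →
      ∀ (K : IntermediateField ℚ ℂ) [NumberField K] (a : ℕ → K) (c : ZMod M → K),
        (∀ n, ((a n : K) : ℂ) = cuspCoeff g n) → (∀ d, ((c d : K) : ℂ) = nebentypus g d) →
      ∀ v : HeightOneSpectrum (𝓞 K),
        ∃ ρ : GaloisRepresentations.FramedGaloisRep ℚ (v.adicCompletion K) 2,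
          ∀ w : HeightOneSpectrum (𝓞 ℚ), ¬ ((primesEquiv w : Nat.Primes) : ℕ) ∣ M →
            (((primesEquiv w : Nat.Primes) : ℕ) : 𝓞 K) ∉ v.asIdeal →
            ρ.IsUnramifiedAt w ∧
            ρ.HasFrobCharpolyAt w
              ((X ^ 2 - C (a ((primesEquiv w : Nat.Primes) : ℕ)) * X +
                C (c ((primesEquiv w : Nat.Primes) : ℕ) *
                  (((primesEquiv w : Nat.Primes) : ℕ) : K) ^ (k - 1))).map
                (algebraMap K (v.adicCompletion K))) :=
  ⟨thm61_newform_of_thm61, thm61_exists_adicGaloisRep_of_thm61_newform⟩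

end Converse

/-! ### Thm. 6.1 modulo lang.S27 and the dictionary, compactness discharged -/

section Langlands

/-- **Deligne–Serre 1974, Thm. 6.1 at every finite place modulo lang.S27 and the adelic
dictionary**, as `thm61_exists_adicGaloisRep_of_langS27_of_dictionary` with the compactness fact of
the `GL₂/ℚ` automorphy datum discharged by the tree (`isCompact_glFiniteIntegralLevel_holds`): the
named fact `thm61_exists_adicGaloisRep` follows from `exists_galoisRep_of_regularAlgebraic`
(Harris–Lan–Taylor–Thorne 2016, Thm. A, with Varma) and the dictionary `hdict` alone (eigenform
`g ∈ S_k(Γ₁(M), χ)`, `k ≥ 2` ↦ regular algebraic cuspidal `π` on `GL₂(𝔸_ℚ)` with Satake parameter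
`{(√p β₁)⁻¹, (√p β₂)⁻¹}` at `p ∤ M`, `β_j` the roots of `X² - a_p X + χ(p) p^{k-1}`).
[cite: DeligneSerreASENS1974, Thm. 6.1 (p. 520)] [cite: HarrisLanTaylorThorneRMS2016, Thm. A (p. 3)] -/
theorem thm61_exists_adicGaloisRep_of_langS27_of_dictionary'
    (h27 : exists_galoisRep_of_regularAlgebraic)
    (hdict : ∀ (M : ℕ) [NeZero M] (k : ℤ), 2 ≤ k →
      ∀ (g : CuspForm (Gamma1 M) k) (χ : DirichletCharacter ℂ M),
        g ∈ nebentypusSubspace M k χ → g ≠ 0 →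
      ∀ (a : ℕ → ℂ),
        (∀ (p : ℕ) (hp : p.Prime), ¬ p ∣ M →
          (haveI : NeZero p := ⟨hp.ne_zero⟩; heckeT (Gamma1 M) k p g) = a p • g) →
      ∃ π : CuspidalAutomorphicRepData 2 ℚ (isCompact_glFiniteIntegralLevel_holds 2 ℚ),
        π.1.IsRegularAlgebraic ∧
        ∀ w : HeightOneSpectrum (𝓞 ℚ), ¬ ((primesEquiv w : Nat.Primes) : ℕ) ∣ M →
          π.1.HasSatakeParamAt w
            ((X ^ 2 - C (a ((primesEquiv w : Nat.Primes) : ℕ)) * X +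
                C (χ ((primesEquiv w : Nat.Primes) : ℕ) *
                  (((primesEquiv w : Nat.Primes) : ℕ) : ℂ) ^ (k - 1)) : ℂ[X]).roots.map
              fun β ↦ (((Real.sqrt ((primesEquiv w : Nat.Primes) : ℕ) : ℝ) : ℂ) * β)⁻¹)) :
    thm61_exists_adicGaloisRep :=
  thm61_exists_adicGaloisRep_of_langS27_of_dictionary h27 (isCompact_glFiniteIntegralLevel_holds 2 ℚ)
    hdict

end Langlands

end Literature.NumberTheory.EllipticCurves.ModularForms.DeligneSerre1974

end
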